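import Literature.MathematicalPhysics.QuantumFieldTheory.Balaban1983to89.B4Thm19RegionLp
import Literature.MathematicalPhysics.QuantumFieldTheory.Balaban1983to89.B4Thm19BoxHolderAll

/-!
# `Balaban1983to89.B4Thm19RegionLpAll` — [Balaban1983RegularityDecay] THEOREM p. 573, INEQUALITY (1.9) (HÖLDER MEMBER)
# FOR A GENERAL REGION `Ω` UNDER `R₀`, ALL PAIRS `x ≠ x′`: close pairs by `B4Thm19RegionLp.thm19_holder_region`, far
# pairs by the derivative member `B4Thm110RegionLpDeriv.thm110_deriv_region` at `x` and at `x′`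

statement-level skeleton of published theorems with citation tags; proofs where landed; nothing here is a claim about the Yang–Mills mass gap

WHAT THIS FILE DOES.  p17's `B4Thm19BoxHolderAll` (boxes) transported to a general finite union `Ω` of `K`-blocks: for
a far pair (`32|x−x′|_∞ > ηM₁`) the Hölder weight `(η^{-1}/|x−x′|_∞)^α` is `≤ 2` and the Hölder quotient is bounded by
the derivative member at `x′` (through the orthogonal transport `U(A(Γ))`, `|U v|_∞ ≤ N|v|_∞`) plus the derivative
member at `x`; the cube size is `K = K₁K₂` (`K₁` of the close-pair theorem, `K₂` of the derivative member; a union of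
`K₁K₂`-blocks is a union of `K₁`- and of `K₂`-blocks, `isBlockUnion_of_mul`).  **`thm19_holder_region_all`**: the
printed (1.9) for every pair `x ≠ x′` with forward bonds in `Ω`, every nearest-neighbour contour of length
`≤ (d+1)|x−x′|_∞` within `|x−x′|_∞` of `x`, under `R₀` at `x` and at `x′` (radius `K(d+4)` unit labels) and the
support of `f` at `ℓ^∞`-distance `≥ D ≥ 0` from both `x` and `x′`.

HONEST SCOPE.  As `B4Thm19RegionLp` / `B4Thm110RegionLpDeriv` (abelian one-parameter flow = the print's (1.2),
component fields, staircase contours on the cubes' boxes, `ℓ^∞` over sites and colours, the `L²`-comparison `V`, `K`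
chosen existentially after `d, N`, the flow, `L`, the windows and `α`); (1.11)–(1.12) for general `Ω` are not touched.
No `Prop` fact, no `sorry`; axioms standard.
-/

namespace Literature.MathematicalPhysics.QuantumFieldTheory.Balaban1983to89.B4Thm19RegionLpAll

open Literature.MathematicalPhysics.QuantumFieldTheory.Balaban1983to89.B4Reflection242 (boxDom nbrs blk)
open Literature.MathematicalPhysics.QuantumFieldTheory.Balaban1983to89.B4GaugeCovariance
open Literature.MathematicalPhysics.QuantumFieldTheory.Balaban1983to89.B4Lower18 (fineDom mem_fineDom IsBlockUnion)
open Literature.MathematicalPhysics.QuantumFieldTheory.Balaban1983to89.B4Lower18Regular (e1)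
open Literature.MathematicalPhysics.QuantumFieldTheory.Balaban1983to89.B4Lemma21Region (regionOp regionDeriv)
open Literature.MathematicalPhysics.QuantumFieldTheory.Balaban1983to89.B4Lemma22EtaBox (vol vol_pos)
open Literature.MathematicalPhysics.QuantumFieldTheory.Balaban1983to89.B4Eq221L2FactorRegion (acBond)
open Literature.MathematicalPhysics.QuantumFieldTheory.Balaban1983to89.B4WalkRouteRegion (rpos)
open Literature.MathematicalPhysics.QuantumFieldTheory.Balaban1983to89.B4ContourShift (supNorm supNorm_nonneg)
open Literature.MathematicalPhysics.QuantumFieldTheory.Balaban1983to89.B4Lemma22HolderBox (IsNNChain transport_fieldLink)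
open Literature.MathematicalPhysics.QuantumFieldTheory.Balaban1983to89.B4HolderChainTools (one_le_supNorm_of_ne)
open Literature.MathematicalPhysics.QuantumFieldTheory.Balaban1983to89.B4Ineq110LpChain (lpv)
open Literature.MathematicalPhysics.QuantumFieldTheory.Balaban1983to89.B4Thm110RegionLpDeriv (thm110_deriv_region)
open Literature.MathematicalPhysics.QuantumFieldTheory.Balaban1983to89.B4Thm19RegionLp (thm19_holder_region)
open Literature.MathematicalPhysics.QuantumFieldTheory.Balaban1983to89.B4Thm19BoxHolderAll (rpow_le_max_one
  abs_U_mulVec_apply_le)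
open scoped Matrix

noncomputable section

variable {d : ℕ}

/-! ## §1. A union of `K₁K₂`-blocks is a union of `K₁`-blocks -/

/-- a finite union of `K₁K₂`-blocks is a finite union of `K₁`-blocks. [cite: Balaban1983RegularityDecay, (1.1) p.572 «Ω … a sum of big blocks», dictionary] -/
theorem isBlockUnion_of_mul {K₁ K₂ : ℕ} {Ωc : Finset (Fin (d + 1) → ℤ)}
    (h : IsBlockUnion (K₁ * K₂) Ωc) : IsBlockUnion K₁ Ωc := by
  intro x hx z hz
  refine h hx ?_
  funext ν
  have hzν : blk K₁ z ν = blk K₁ x ν := congrFun hz ν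
  have hK₂0 : (0 : ℤ) ≤ K₁ := Int.natCast_nonneg K₁
  show z ν / (((K₁ * K₂ : ℕ)) : ℤ) = x ν / (((K₁ * K₂ : ℕ)) : ℤ)
  have h1 : z ν / (K₁ : ℤ) = x ν / (K₁ : ℤ) := hzν
  rw [Nat.cast_mul, ← Int.ediv_ediv_of_nonneg hK₂0, ← Int.ediv_ediv_of_nonneg hK₂0, h1]

variable {ι : Type} [Fintype ι] [DecidableEq ι]

/-! ## §2. THEOREM (1.9) on a general region, all pairs -/

/-- **THEOREM p. 573, INEQUALITY (1.9) — the HÖLDER member — FOR A GENERAL REGION `Ω` UNDER `R₀`, ALL PAIRS `x ≠ x′`,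
η-UNIFORM** (close pairs `32|x−x′|_∞ ≤ ηM₁`: `B4Thm19RegionLp.thm19_holder_region`; far pairs: the Hölder weight is
`≤ 2` and the quotient is bounded by the derivative member (1.10) `B4Thm110RegionLpDeriv.thm110_deriv_region` at `x′`
(through the orthogonal transport) and at `x`).  For every `α < 1` there are `K ≥ 16` (`8 ∣ K`) and `c₀ > 0` such that
for every `(c, β)`, `β > 0`, there is `e₁ > 0` with: for every step `k ≥ 1`, `a ∈ [a₋, a₊]`, `0 ≤ m² ≤ m₊²`, every
finite union `Ω` of `K`-blocks, every `A` regular (1.7) on `Ω` with `0 < e ≤ e₁`, every `μ`, every pair `x ≠ x′` with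
`x + e_μ, x′ + e_μ ∈ Ω`, every nearest-neighbour contour `Γ = (x, l)` to `x′` of length `≤ (d+1)|x−x′|_∞` within
`|x−x′|_∞` of `x`, the `R₀` restriction at `x` and at `x′` (radius `K(d+4)` unit labels), every `f` supported at
`ℓ^∞`-distance `≥ D ≥ 0` (fine units) from `x` and from `x′` with `‖f‖_{2,η} ≤ V‖f‖_∞`, and every colour `i`:
`(η^{-1}/|x−x′|_∞)^α·|(U(A(Γ))(D^η_{A,μ}G_k(Ω,A)f)(x′) − (D^η_{A,μ}G_k(Ω,A)f)(x))_i| ≤ c₀·V·exp(−D/(nK))·‖f‖_∞`.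
[cite: Balaban1983RegularityDecay, Theorem p.573 (1.9)–(1.10); (1.3)–(1.4) p.572; §2 pp.575–579] -/
theorem thm19_holder_region_all (F : OrthFlow ι) {ℓ₁ : ℝ} (hℓ₁ : 0 ≤ ℓ₁)
    (hLip : ∀ t (v : ι → ℝ), ((F.U t - 1) *ᵥ v) ⬝ᵥ ((F.U t - 1) *ᵥ v) ≤ (ℓ₁ * t) ^ 2 * (v ⬝ᵥ v))
    (d ℓ : ℕ) (hℓ : 1 ≤ ℓ) (amin aplus m2plus : ℝ) (ha : 0 < amin) (α : ℝ) (hα0 : 0 ≤ α) (hα1 : α < 1) :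
    ∃ K : ℕ, 16 ≤ K ∧ 8 ∣ K ∧ ∃ c₀ : ℝ, 0 < c₀ ∧ ∀ (creg β : ℝ), 0 ≤ creg → 0 < β →
      ∃ e₁ : ℝ, 0 < e₁ ∧ ∀ (k : ℕ), 1 ≤ k → ∀ (hn : 1 ≤ (ℓ + 1) ^ k) (a m2 : ℝ),
      amin ≤ a → a ≤ aplus → 0 ≤ m2 → m2 ≤ m2plus →
      ∀ (Ωc : Finset (Fin (d + 1) → ℤ)), IsBlockUnion K Ωc →
      ∀ (Ac : (Fin (d + 1) → ℤ) → Fin (d + 1) → ℝ) (e : ℝ), 0 < e → e ≤ e₁ →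
        (∀ x ∈ fineDom ((ℓ + 1) ^ k) Ωc, ∀ μ ν : Fin (d + 1),
          |Ac (x + e1 μ) ν - Ac x ν| ≤ creg * e ^ (β - 1) / ((ℓ + 1) ^ k : ℕ)) →
      ∀ (μ : Fin (d + 1)) (x x' : ↥(fineDom ((ℓ + 1) ^ k) Ωc)), x.1 + e1 μ ∈ fineDom ((ℓ + 1) ^ k) Ωc →
        x'.1 + e1 μ ∈ fineDom ((ℓ + 1) ^ k) Ωc → x'.1 ≠ x.1 →
      ∀ (l : List ↥(fineDom ((ℓ + 1) ^ k) Ωc)), IsNNChain x l → pathEnd x l = x' →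
        (l.length : ℝ) ≤ ((d : ℝ) + 1) * supNorm (x'.1 - x.1) →
        (∀ z ∈ l, supNorm (z.1 - x.1) ≤ supNorm (x'.1 - x.1)) →
        (∀ y : Fin (d + 1) → ℤ, (∀ ν, |y ν - blk ((ℓ + 1) ^ k) x.1 ν| ≤ (K : ℤ) * (d + 4)) → y ∈ Ωc) →
        (∀ y : Fin (d + 1) → ℤ, (∀ ν, |y ν - blk ((ℓ + 1) ^ k) x'.1 ν| ≤ (K : ℤ) * (d + 4)) → y ∈ Ωc) →
      ∀ (P : ↥(fineDom ((ℓ + 1) ^ k) Ωc) → Prop) [DecidablePred P] (D : ℝ), 0 ≤ D →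
        (∀ x'', P x'' → ∃ ν, D ≤ |rpos ((ℓ + 1) ^ k) Ωc x ν - rpos ((ℓ + 1) ^ k) Ωc x'' ν|) →
        (∀ x'', P x'' → ∃ ν, D ≤ |rpos ((ℓ + 1) ^ k) Ωc x' ν - rpos ((ℓ + 1) ^ k) Ωc x'' ν|) →
      ∀ (f : ↥(fineDom ((ℓ + 1) ^ k) Ωc) × ι → ℝ), (∀ p, ¬ P p.1 → f p = 0) →
      ∀ (V : ℝ), 1 ≤ V → lpv (vol d ℓ k)⁻¹ 2 f ≤ V * ‖f‖ →
      ∀ i : ι,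
        ((((ℓ + 1) ^ k : ℕ) : ℝ) / supNorm (x'.1 - x.1)) ^ α *
          |(transport (fieldLink F (e / ((ℓ + 1) ^ k : ℕ)) (acBond Ωc Ac)) x l
              *ᵥ fld (regionDeriv F e ((ℓ + 1) ^ k) Ωc Ac μ
                    *ᵥ ((regionOp F e hn (B1.aSeq a ((ℓ : ℝ) + 1) k) m2 Ωc Ac)⁻¹ *ᵥ f)) x'
            - fld (regionDeriv F e ((ℓ + 1) ^ k) Ωc Ac μ
                    *ᵥ ((regionOp F e hn (B1.aSeq a ((ℓ : ℝ) + 1) k) m2 Ωc Ac)⁻¹ *ᵥ f)) x) i|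
          ≤ c₀ * V * Real.exp (-(D / ((((ℓ + 1) ^ k : ℕ) : ℝ) * K))) * ‖f‖ := by
  classical
  obtain ⟨K₁, hK₁, h8₁, c₁, hc₁, H₁⟩ := thm19_holder_region F hℓ₁ hLip d ℓ hℓ amin aplus m2plus ha α hα0 hα1
  obtain ⟨K₂, hK₂, -, c₂, hc₂, H₂⟩ := thm110_deriv_region F hℓ₁ hLip d ℓ hℓ amin aplus m2plus ha
  set K : ℕ := K₁ * K₂ with hK
  have hK₂1 : 1 ≤ K₂ := le_trans (by norm_num) hK₂
  have hK₁1 : 1 ≤ K₁ := le_trans (by norm_num) hK₁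
  have hK₁K : K₁ ≤ K := by rw [hK]; nlinarith
  have hK₂K : K₂ ≤ K := by rw [hK]; nlinarith
  have hK₂K' : 16 * K₂ ≤ K := by rw [hK]; nlinarith
  have hK16 : 16 ≤ K := hK₁.trans hK₁K
  have h8 : 8 ∣ K := dvd_mul_of_dvd_left h8₁ K₂
  have hK₁r : (0 : ℝ) < K₁ := by exact_mod_cast lt_of_lt_of_le (by norm_num) hK₁
  have hK₂r : (0 : ℝ) < K₂ := by exact_mod_cast lt_of_lt_of_le (by norm_num) hK₂
  have hKr : (0 : ℝ) < K := by exact_mod_cast lt_of_lt_of_le (by norm_num) hK16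
  set c : ℝ := max c₁ (2 * (((Fintype.card ι : ℝ) + 1) * c₂)) with hc
  refine ⟨K, hK16, h8, c, lt_of_lt_of_le hc₁ (le_max_left _ _), fun creg β hcreg hβ => ?_⟩
  obtain ⟨e₁, he₁, H₁'⟩ := H₁ creg β hcreg hβ
  obtain ⟨e₂, he₂, H₂'⟩ := H₂ creg β hcreg hβ
  refine ⟨min e₁ e₂, lt_min he₁ he₂, ?_⟩
  intro k hk hn a m2 ea1 ea2 em1 em2 Ωc hΩ Ac e he hle h17 μ x x' hxμ hx'μ hne l hl hlend hlen hlnear hRx hRx' P _ D hD0 hD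
    hD' f hfP V hV hfV i
  have hnr : (0 : ℝ) < (((ℓ + 1) ^ k : ℕ) : ℝ) := by exact_mod_cast hn
  have hV0 : (0 : ℝ) ≤ V := zero_le_one.trans hV
  -- `Ω` is a union of `K₁`-blocks and of `K₂`-blocks
  have hΩ₁ : IsBlockUnion K₁ Ωc := isBlockUnion_of_mul (K₂ := K₂) (by rw [← hK]; exact hΩ)
  have hΩ₂ : IsBlockUnion K₂ Ωc := isBlockUnion_of_mul (K₂ := K₁) (by rw [mul_comm, ← hK]; exact hΩ)
  -- the `R₀` restrictions of the two theorems
  have hR₁ : ∀ y : Fin (d + 1) → ℤ, (∀ ν, |y ν - blk ((ℓ + 1) ^ k) x.1 ν| ≤ (K₁ : ℤ) * (d + 4)) → y ∈ Ωc := by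
    intro y hy
    refine hRx y fun ν => (hy ν).trans ?_
    have : (K₁ : ℤ) ≤ K := by exact_mod_cast hK₁K
    nlinarith
  have hR₂ : ∀ (z : ↥(fineDom ((ℓ + 1) ^ k) Ωc)),
      (∀ y : Fin (d + 1) → ℤ, (∀ ν, |y ν - blk ((ℓ + 1) ^ k) z.1 ν| ≤ (K : ℤ) * (d + 4)) → y ∈ Ωc) →
      ∀ y : Fin (d + 1) → ℤ, (∀ ν, |y ν - blk ((ℓ + 1) ^ k) z.1 ν| ≤ (K₂ : ℤ) * (d + 3) + 1) → y ∈ Ωc := by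
    intro z hz y hy
    refine hz y fun ν => (hy ν).trans ?_
    have h1 : (16 : ℤ) * K₂ ≤ K := by exact_mod_cast hK₂K'
    have h2 : (1 : ℤ) ≤ K₂ := by exact_mod_cast hK₂1
    nlinarith
  -- `e^{−D/(nKᵢ)} ≤ e^{−D/(nK)}`
  have hexpK : ∀ K' : ℕ, (0 : ℝ) < K' → K' ≤ K →
      Real.exp (-(D / ((((ℓ + 1) ^ k : ℕ) : ℝ) * K'))) ≤ Real.exp (-(D / ((((ℓ + 1) ^ k : ℕ) : ℝ) * K))) := by
    intro K' hK'0 hK'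
    refine Real.exp_le_exp.2 (neg_le_neg (div_le_div_of_nonneg_left hD0 (by positivity) ?_))
    exact mul_le_mul_of_nonneg_left (by exact_mod_cast hK') hnr.le
  have hrest : 0 ≤ V * Real.exp (-(D / ((((ℓ + 1) ^ k : ℕ) : ℝ) * K))) * ‖f‖ := by positivity
  by_cases hclose : 32 * supNorm (x'.1 - x.1) ≤ (((ℓ + 1) ^ k : ℕ) : ℝ) * K₁
  · -- close pairs: the random-walk expansion for the Hölder probe
    have hb := H₁' k hk hn a m2 ea1 ea2 em1 em2 Ωc hΩ₁ Ac e he (hle.trans (min_le_left _ _)) h17 μ x x' hxμ hx'μ hne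
      hclose l hl hlend hlen hlnear hR₁ P D hD f hfP V hV hfV i
    refine hb.trans ?_
    calc c₁ * V * Real.exp (-(D / ((((ℓ + 1) ^ k : ℕ) : ℝ) * K₁))) * ‖f‖
        = c₁ * (V * Real.exp (-(D / ((((ℓ + 1) ^ k : ℕ) : ℝ) * K₁))) * ‖f‖) := by ring
      _ ≤ c * (V * Real.exp (-(D / ((((ℓ + 1) ^ k : ℕ) : ℝ) * K))) * ‖f‖) := by
          refine mul_le_mul (le_max_left _ _) ?_ (by positivity) (hc₁.le.trans (le_max_left _ _))
          exact mul_le_mul_of_nonneg_right (mul_le_mul_of_nonneg_left (hexpK K₁ hK₁r hK₁K) hV0) (norm_nonneg _)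
      _ = c * V * Real.exp (-(D / ((((ℓ + 1) ^ k : ℕ) : ℝ) * K))) * ‖f‖ := by ring
  · -- far pairs: Hölder weight `≤ 2`, derivative member at `x` and at `x′`
    set r : ℝ := supNorm (x'.1 - x.1) with hr
    have hr0 : 0 < r := lt_of_lt_of_le zero_lt_one (one_le_supNorm_of_ne hne)
    have hw2 : ((((ℓ + 1) ^ k : ℕ) : ℝ) / r) ^ α ≤ 2 := by
      refine (rpow_le_max_one (div_nonneg hnr.le hr0.le) hα0 hα1.le).trans (max_le (by norm_num) ?_)
      rw [div_le_iff₀ hr0]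
      have hK₁16 : (16 : ℝ) ≤ K₁ := by exact_mod_cast hK₁
      push Not at hclose
      nlinarith
    have hx1 := H₂' k hk hn a m2 ea1 ea2 em1 em2 Ωc hΩ₂ Ac e he (hle.trans (min_le_right _ _)) h17 μ x hxμ (hR₂ x hRx)
      P D hD f hfP V hV hfV
    have hx2 := H₂' k hk hn a m2 ea1 ea2 em1 em2 Ωc hΩ₂ Ac e he (hle.trans (min_le_right _ _)) h17 μ x' hx'μ
      (hR₂ x' hRx') P D hD' f hfP V hV hfV
    set Ψ := regionDeriv F e ((ℓ + 1) ^ k) Ωc Ac μ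
      *ᵥ ((regionOp F e hn (B1.aSeq a ((ℓ : ℝ) + 1) k) m2 Ωc Ac)⁻¹ *ᵥ f) with hΨ
    have hb0 : 0 ≤ c₂ * V * Real.exp (-(D / ((((ℓ + 1) ^ k : ℕ) : ℝ) * K₂))) * ‖f‖ := by positivity
    have hU : |(transport (fieldLink F (e / ((ℓ + 1) ^ k : ℕ)) (acBond Ωc Ac)) x l *ᵥ fld Ψ x') i|
        ≤ (Fintype.card ι : ℝ) * (c₂ * V * Real.exp (-(D / ((((ℓ + 1) ^ k : ℕ) : ℝ) * K₂))) * ‖f‖) := by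
      rw [transport_fieldLink]
      exact abs_U_mulVec_apply_le F _ _ hb0 (fun k' => hx2 k') i
    have hVx : |fld Ψ x i| ≤ c₂ * V * Real.exp (-(D / ((((ℓ + 1) ^ k : ℕ) : ℝ) * K₂))) * ‖f‖ := hx1 i
    have hdiff : |(transport (fieldLink F (e / ((ℓ + 1) ^ k : ℕ)) (acBond Ωc Ac)) x l *ᵥ fld Ψ x' - fld Ψ x) i|
        ≤ ((Fintype.card ι : ℝ) + 1) * (c₂ * V * Real.exp (-(D / ((((ℓ + 1) ^ k : ℕ) : ℝ) * K₂))) * ‖f‖) := by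
      rw [Pi.sub_apply]
      refine (abs_sub _ _).trans ?_
      linarith
    have hw0 : 0 ≤ ((((ℓ + 1) ^ k : ℕ) : ℝ) / r) ^ α := Real.rpow_nonneg (div_nonneg hnr.le hr0.le) α
    calc ((((ℓ + 1) ^ k : ℕ) : ℝ) / r) ^ α
          * |(transport (fieldLink F (e / ((ℓ + 1) ^ k : ℕ)) (acBond Ωc Ac)) x l *ᵥ fld Ψ x' - fld Ψ x) i|
        ≤ 2 * (((Fintype.card ι : ℝ) + 1) * (c₂ * V * Real.exp (-(D / ((((ℓ + 1) ^ k : ℕ) : ℝ) * K₂))) * ‖f‖)) :=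
          mul_le_mul hw2 hdiff (abs_nonneg _) zero_le_two
      _ = 2 * (((Fintype.card ι : ℝ) + 1) * c₂) * (V * Real.exp (-(D / ((((ℓ + 1) ^ k : ℕ) : ℝ) * K₂))) * ‖f‖) := by
          ring
      _ ≤ c * (V * Real.exp (-(D / ((((ℓ + 1) ^ k : ℕ) : ℝ) * K))) * ‖f‖) := by
          refine mul_le_mul (le_max_right _ _) ?_ (by positivity) (hc₁.le.trans (le_max_left _ _))
          exact mul_le_mul_of_nonneg_right (mul_le_mul_of_nonneg_left (hexpK K₂ hK₂r hK₂K) hV0) (norm_nonneg _)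
      _ = c * V * Real.exp (-(D / ((((ℓ + 1) ^ k : ℕ) : ℝ) * K))) * ‖f‖ := by ring

end

end Literature.MathematicalPhysics.QuantumFieldTheory.Balaban1983to89.B4Thm19RegionLpAll
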